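import Summits.BirchSwinnertonDyer.Rank1Residual.WAll.TargetAdditiveAtThreeCells
import HarnessLib
import HarnessLib.Audit.Tags

/-!
# Rung W-ALL of ladder BSD (D-0120) — row 2 at `p = 3`, the POTENTIALLY SUPERSINGULAR block by rank
# (cell `bsd-wall`, lane (2), seat `bsd-wall-ty-1`; new small file importing `WAll.TargetAdditiveAtThreeCells`)

HONEST FRAMING (cell `bsd-wall`, run/shared/lean/pub/bsd-wall/; brief `WALL-BRIEF-v1.md` sha16
b966bf16da27706e §2): STATEMENTS AND BOOKKEEPING ONLY — nothing asserted, nothing booked, no named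
fact, no published theorem restated; the three `@[conjecture] def`s below are OPEN obligations and
SLICES of the registered row-2 leaves (`WAllExclAdditive`, `WAllExclAdditiveAtThree[RankZero|RankOne]`)
— exactly the union of two cell atoms of `TargetAdditiveAtThreeCells.lean` each.

WHY ONE MORE NAME. The lead's scoping memo of record `ROW2-AT3-SCOPING-v1.md` (v1.3, 2026-08-27T06:37Z,
on census `ROW2-AT3-SUBBLOCKS-v1.md` 85b4c5522424eded; register A2 ROUND 494, `N < 5·10⁵`, unit =
isogeny class) recommends ONE new seat on its BLOCK A = «rank one at a prime of potentially
SUPERSINGULAR additive reduction, `p = 3`»: by census cell × rank at `3` the wild cell (w) carries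
`r = 1` `13 573` classes, the tame cell `(t′)` `r = 1` `3 533`, the quadratic supersingular cell
`(G) ∧ ss` `r = 1` `355` (`r = 0` `705`) — `17 461` rank-one classes (`18 166` with the whole
`(G) ∧ ss` cell, as the memo counts it) of the `43 039`-class `p = 3` block, today hanging on three
bare RESIDUAL items with no crux and no print: 19200 `WildRankOne` (K9), 19984 `TameRankOne` (K8-t′),
19120 `Gss2AtThree` (K8). The complementary cells (M) and (G-ord) at `3` are rung K1's
(`AdditiveBranchIMC`). A route born on block A should `--closes-target` ONE leaf; this file names it
(`WAllExclAddPotSSAtThreeRankOne`, with its rank-`0` and rank-`≤ 1` companions), PROVES it is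
EXACTLY `WAllExclAddTameSSAtThreeRankOne ∧ WAllExclAddWildRankOne` (O5@3 ∪ O6) and EXACTLY the
"neither (M) nor (G-ord)" part of the `p = 3` rank-one slice (`Additive.addv_odd_cells W 3` and the
cells' disjointness — no mathematics), so that `WAllExclAdditiveAtThreeRankOne ⟺ (M)@3.r1 ∧
(G-ord)@3.r1 ∧ block A`, and records that the three residual items of record (shapes verbatim,
`Typed.MissingPPartAt` currency) close block A BY NAME granted GZK.

References: `WAll/TargetAdditiveAtThreeCells.lean` (cell × rank atoms at `3`, bridges from items
19120 / 19200 / 19984), `WAll/TargetPrimeSlices.lean`, `WAll/TargetAdditive.lean`, `WAll/Target.lean`;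
`Additive/PotSupersingularClasses.lean` (`ClassO5`, `ClassO6`, `addv_odd_cells`,
`ClassO5.not_subM_not_subW`, `ClassO5.not_typeGOrd`, `ClassO6.addv`); HOME `ROW2-AT3-SCOPING-v1.md`
§0–§3; [cite: Miller2011LMS, §1 and Def. 1.1] (the currency `BSD(E,p)`).
-/

noncomputable section

open scoped Classical

open WeierstrassCurve Literature.NumberTheory.EllipticCurves
  Literature.NumberTheory.EllipticCurves.Rank1Residual Literature.NumberTheory.EllipticCurves.ModularForms
open Summit.BirchSwinnertonDyer.Rank1Residual

set_option autoImplicit false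

namespace Summit.BirchSwinnertonDyer

/-! ### §1. The potentially supersingular block at `p = 3` (O5 ∪ O6), by rank -/

/-- **BLOCK A — rank one at potentially SUPERSINGULAR additive `3` (OPEN).** Non-CM `E/ℚ` (globally
minimal `W`), additive at `3` of potentially good NON-ordinary type — tame (`Additive.ClassO5 W 3`:
`(G) ∧ ss` with `e = 2`, or `(t′)` with `e = 4`) or wild (`Additive.ClassO6 W 3`, `e ∈ {3, 6, 12}`) —,
`ord_{s=1} L(E,s) = 1` ⇒ `BSD(E,3)`. Census of record: `17 461` rank-one classes at `N < 5·10⁵`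
(`13 573` wild + `3 533` tame `(t′)` + `355` `(G) ∧ ss`), no printed decider (memo
ROW2-AT3-SCOPING-v1 §2 row A: Heegner–Kolyvagin exactness inputs are `p ≥ 5`; `p`-adic Gross–Zagier
printed for potentially ordinary / semistable or GOOD supersingular `p` only; signed Iwasawa theory
needs good reduction). [folklore] -/
@[conjecture] def WAllExclAddPotSSAtThreeRankOne : Prop :=
  ∀ (W : WeierstrassCurve ℚ) [W.IsElliptic] [W.IsGloballyMinimal],
    ¬ W.HasCM → Additive.ClassO5 W 3 ∨ Additive.ClassO6 W 3 → W.analyticRank = 1 → BSDp W 3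

/-- Rank zero at potentially supersingular additive `3` (OPEN): non-CM, `Additive.ClassO5 W 3 ∨
Additive.ClassO6 W 3`, `ord_{s=1} L(E,s) = 0` ⇒ `BSD(E,3)` (`17 924` classes of record: `13 089` wild
+ `4 130` `(t′)` + `705` `(G) ∧ ss`; K9 / K8-t′ Kato-descent territory, memo blocks G/H/J). [folklore] -/
@[conjecture] def WAllExclAddPotSSAtThreeRankZero : Prop :=
  ∀ (W : WeierstrassCurve ℚ) [W.IsElliptic] [W.IsGloballyMinimal],
    ¬ W.HasCM → Additive.ClassO5 W 3 ∨ Additive.ClassO6 W 3 → W.analyticRank = 0 → BSDp W 3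

/-- Potentially supersingular additive `3`, rank `≤ 1` (OPEN): non-CM, `Additive.ClassO5 W 3 ∨
Additive.ClassO6 W 3`, `r ≤ 1` ⇒ `BSD(E,3)` (`35 385` of the `43 039` classes of the `p = 3` block).
[folklore] -/
@[conjecture] def WAllExclAddPotSSAtThree : Prop :=
  ∀ (W : WeierstrassCurve ℚ) [W.IsElliptic] [W.IsGloballyMinimal],
    ¬ W.HasCM → Additive.ClassO5 W 3 ∨ Additive.ClassO6 W 3 → W.analyticRank ≤ 1 → BSDp W 3

/-! ### §2. Glue (no mathematics) -/

/-- **Block A = O5@3.r1 ∧ O6.r1.** [folklore] -/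
theorem wAllExclAddPotSSAtThreeRankOne_iff :
    WAllExclAddPotSSAtThreeRankOne ↔
      WAllExclAddTameSSAtThreeRankOne ∧ WAllExclAddWildRankOne :=
  ⟨fun h ↦ ⟨fun W _ _ hcm hO hr ↦ h W hcm (Or.inl hO) hr, fun W _ _ hcm hO hr ↦ h W hcm (Or.inr hO) hr⟩,
    fun ⟨h5, h6⟩ W _ _ hcm hO hr ↦ hO.elim (fun hO ↦ h5 W hcm hO hr) (fun hO ↦ h6 W hcm hO hr)⟩

/-- The rank-`0` block = O5@3.r0 ∧ O6.r0. [folklore] -/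
theorem wAllExclAddPotSSAtThreeRankZero_iff :
    WAllExclAddPotSSAtThreeRankZero ↔
      WAllExclAddTameSSAtThreeRankZero ∧ WAllExclAddWildRankZero :=
  ⟨fun h ↦ ⟨fun W _ _ hcm hO hr ↦ h W hcm (Or.inl hO) hr, fun W _ _ hcm hO hr ↦ h W hcm (Or.inr hO) hr⟩,
    fun ⟨h5, h6⟩ W _ _ hcm hO hr ↦ hO.elim (fun hO ↦ h5 W hcm hO hr) (fun hO ↦ h6 W hcm hO hr)⟩

/-- The rank-`≤ 1` block = O5@3 ∧ O6 (`WAllExclAddTameSSAtThree ∧ WAllExclAddWild`). [folklore] -/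
theorem wAllExclAddPotSSAtThree_iff :
    WAllExclAddPotSSAtThree ↔ WAllExclAddTameSSAtThree ∧ WAllExclAddWild := by
  rw [wAllExclAddWild_iff_three]
  exact ⟨fun h ↦ ⟨fun W _ _ hcm hO hr ↦ h W hcm (Or.inl hO) hr, fun W _ _ hcm hO hr ↦ h W hcm (Or.inr hO) hr⟩,
    fun ⟨h5, h6⟩ W _ _ hcm hO hr ↦ hO.elim (fun hO ↦ h5 W hcm hO hr) (fun hO ↦ h6 W hcm hO hr)⟩

/-- The rank-`≤ 1` block ⟺ its two rank blocks. [folklore] -/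
theorem wAllExclAddPotSSAtThree_iff_ranks :
    WAllExclAddPotSSAtThree ↔ WAllExclAddPotSSAtThreeRankZero ∧ WAllExclAddPotSSAtThreeRankOne :=
  ⟨fun h ↦ ⟨fun W _ _ hcm hO hr ↦ h W hcm hO (by omega), fun W _ _ hcm hO hr ↦ h W hcm hO (by omega)⟩,
    fun ⟨h0, h1⟩ W _ _ hcm hO hr ↦ (Nat.le_one_iff_eq_zero_or_eq_one.mp hr).elim
      (h0 W hcm hO) (h1 W hcm hO)⟩

/-- **"Potentially supersingular at `3`" = "additive at `3`, neither (M) nor (G-ord)"**: at an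
additive `3`, `ClassO5 W 3 ∨ ClassO6 W 3 ↔ ¬ SubM W 3 ∧ ¬ SubGordOrd W 3` (`addv_odd_cells` and the
cells' disjointness `ClassO5.not_subM_not_subW`, `ClassO5.not_typeGOrd`, `ClassO6.addv`). [folklore] -/
theorem classO5_or_classO6_three_iff (W : WeierstrassCurve ℚ) [W.IsElliptic] [W.IsGloballyMinimal]
    (hadd : Addv W 3) :
    Additive.ClassO5 W 3 ∨ Additive.ClassO6 W 3 ↔ ¬ Additive.SubM W 3 ∧ ¬ Additive.SubGordOrd W 3 := by
  constructor
  · rintro (h5 | h6)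
    · exact ⟨h5.not_subM_not_subW.1, fun hG ↦ h5.not_typeGOrd hG.2⟩
    · exact ⟨h6.addv.2.2.1, fun hG ↦ h6.addv.2.2.2 hG.1.2.1⟩
  · rintro ⟨hM, hG⟩
    rcases Additive.addv_odd_cells W 3 (by decide) hadd with h | h | h | h
    · exact absurd h hM
    · exact absurd h hG
    · exact Or.inl h
    · exact Or.inr h

/-- Block A in the "neither (M) nor (G-ord)" reading: `WAllExclAddPotSSAtThreeRankOne` ⟺ BSD(E,3)
for every non-CM `E` additive at `3`, not potentially multiplicative, not of (G)-ordinary type, of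
analytic rank `1`. [folklore] -/
theorem wAllExclAddPotSSAtThreeRankOne_iff_not_subM_not_subGordOrd :
    WAllExclAddPotSSAtThreeRankOne ↔
      ∀ (W : WeierstrassCurve ℚ) [W.IsElliptic] [W.IsGloballyMinimal],
        ¬ W.HasCM → Addv W 3 → ¬ Additive.SubM W 3 → ¬ Additive.SubGordOrd W 3 →
          W.analyticRank = 1 → BSDp W 3 := by
  constructor
  · intro h W _ _ hcm hadd hM hG hr
    exact h W hcm ((classO5_or_classO6_three_iff W hadd).2 ⟨hM, hG⟩) hr
  · intro h W _ _ hcm hO hr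
    have hadd : Addv W 3 := hO.elim (fun h5 ↦ h5.2.1) (fun h6 ↦ h6.2.1)
    obtain ⟨hM, hG⟩ := (classO5_or_classO6_three_iff W hadd).1 hO
    exact h W hcm hadd hM hG hr

/-- **Row 2 at `3`, rank `1` ⟺ (M)@3.r1 ∧ (G-ord)@3.r1 ∧ BLOCK A** — the K1 part and the
potentially supersingular part of the `21 865`-class rank-one slice. [folklore] -/
theorem wAllExclAdditiveAtThreeRankOne_iff_potMult_potOrd_potSS :
    WAllExclAdditiveAtThreeRankOne ↔
      WAllExclAddPotMultAtThreeRankOne ∧ WAllExclAddPotOrdAtThreeRankOne ∧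
        WAllExclAddPotSSAtThreeRankOne := by
  rw [wAllExclAdditiveAtThreeRankOne_iff_cells, wAllExclAddPotSSAtThreeRankOne_iff]

/-- Row 2 at `3`, rank `0` ⟺ (M)@3.r0 ∧ (G-ord)@3.r0 ∧ the rank-`0` potentially supersingular
block. [folklore] -/
theorem wAllExclAdditiveAtThreeRankZero_iff_potMult_potOrd_potSS :
    WAllExclAdditiveAtThreeRankZero ↔
      WAllExclAddPotMultAtThreeRankZero ∧ WAllExclAddPotOrdAtThreeRankZero ∧
        WAllExclAddPotSSAtThreeRankZero := by
  rw [wAllExclAdditiveAtThreeRankZero_iff_cells, wAllExclAddPotSSAtThreeRankZero_iff]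

/-- Row 2 at `3` (`r ≤ 1`) ⟺ (M)@3 ∧ (G-ord)@3 ∧ the potentially supersingular block. [folklore] -/
theorem wAllExclAdditiveAtThree_iff_potMult_potOrd_potSS :
    WAllExclAdditiveAtThree ↔
      WAllExclAddPotMultAtThree ∧ WAllExclAddPotOrdAtThree ∧ WAllExclAddPotSSAtThree := by
  rw [wAllExclAdditiveAtThree_iff_cellsAtThree, wAllExclAddPotSSAtThree_iff]

/-- **Block A from its three atoms of record**: `(G) ∧ ss`@3 (rank `≤ 1`), `(t′)`@3 in rank `1`,
O6 in rank `1`. [folklore] -/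
theorem wAllExclAddPotSSAtThreeRankOne_of_atoms (hs : WAllExclAddGssAtThree)
    (ht : WAllExclAddTprimeAtThreeRankOne) (hw : WAllExclAddWildRankOne) :
    WAllExclAddPotSSAtThreeRankOne :=
  wAllExclAddPotSSAtThreeRankOne_iff.2
    ⟨wAllExclAddTameSSAtThreeRankOne_of_gss_of_tprimeRankOne hs ht, hw⟩

/-- **Block A ⇐ the three held RESIDUAL items of record + GZK** (shapes verbatim, in the typed
missing-`p`-part currency `Typed.MissingPPartAt`, CM not excluded): 19120 `Gss2AtThree` (rung K8),
19984 `TameRankOne` (rung K8-t′, every odd `p`), 19200 `WildRankOne` (rung K9). So a route that proves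
the three items closes block A by this theorem, and a route born UNDER block A replaces them.
[folklore] -/
theorem wAllExclAddPotSSAtThreeRankOne_of_residuals
    (h19120 : ∀ (W : WeierstrassCurve ℚ) [W.IsElliptic] [W.IsGloballyMinimal] [Fact (3 : ℕ).Prime],
      W.analyticRank ≤ 1 → Addv W 3 → Additive.SubGss W 3 → Typed.MissingPPartAt W 3)
    (h19984 : ∀ (W : WeierstrassCurve ℚ) [W.IsElliptic] [W.IsGloballyMinimal] (p : ℕ) [Fact p.Prime],
      W.analyticRank = 1 → p ≠ 2 → Addv W p → Additive.SubTprime W p → Typed.MissingPPartAt W p)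
    (h19200 : ∀ (W : WeierstrassCurve ℚ) [W.IsElliptic] [W.IsGloballyMinimal] [Fact (3 : ℕ).Prime],
      W.analyticRank = 1 → Additive.ClassO6 W 3 → Typed.MissingPPartAt W 3)
    (hGZK : rank_eq_analyticRank_of_analyticRank_le_one) : WAllExclAddPotSSAtThreeRankOne :=
  wAllExclAddPotSSAtThreeRankOne_of_atoms (wAllExclAddGssAtThree_of_gss2AtThree h19120 hGZK)
    (wAllExclAddTprimeAtThreeRankOne_of_tameRankOne h19984 hGZK)
    (wAllExclAddWildRankOne_of_wildRankOne h19200 hGZK)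

/-- The three blocks of this file follow from `WAll` (each is an instance of it). [folklore] -/
theorem potSSAtThree_of_wAll (h : WAll) :
    WAllExclAddPotSSAtThree ∧ WAllExclAddPotSSAtThreeRankZero ∧ WAllExclAddPotSSAtThreeRankOne :=
  ⟨fun W _ _ _ _ hr ↦ h W 3 hr, fun W _ _ _ _ hr ↦ h W 3 (by omega), fun W _ _ _ _ hr ↦ h W 3 (by omega)⟩

/-- Conversely the potentially supersingular blocks, with the K1 cells at `3`, reassemble the
registered `p = 3` slice of row 2 (bookkeeping summary). [folklore] -/
theorem wAllExclAdditiveAtThree_of_potMult_potOrd_potSS (hM : WAllExclAddPotMultAtThree)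
    (hG : WAllExclAddPotOrdAtThree) (hS : WAllExclAddPotSSAtThree) : WAllExclAdditiveAtThree :=
  wAllExclAdditiveAtThree_iff_potMult_potOrd_potSS.2 ⟨hM, hG, hS⟩

end Summit.BirchSwinnertonDyer

end
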